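import Summits.HubbardSuperconductivity.HubbardSuperconductivity.Theorems.LevyLogBootstrapLevyTransportKernelPositivity
import Literature.MathematicalPhysics.QuantumLattice.SectorGroundStateContinuity
import Literature.MathematicalPhysics.QuantumLattice.FinDimSpectrumSectorGibbsLimit
import Literature.MathematicalPhysics.QuantumLattice.XYOrderDischarges
import Literature.MathematicalPhysics.QuantumLattice.LiebMattisLadder
import HarnessLib

/-!
# Crux `LevyTransport` (stmt-HubbardSuperconductivity-15049, route `LevyLogBootstrap`), skeleton
# `Cruxes/LevyTransport/Lines/birth.lean`: stub 1 `stub_levyMassBranch` — the half-filled ground-state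
# branch has a continuous Lévy mass (defs-free explicit form `stub_levyMassBranch_explicit`)

The skeleton states its stubs over abbreviations declared INSIDE the skeleton (`IsHalfFilledGS`,
`blockKernel`, `levyMass`, …), which `Theorems/` files cannot import (`lint.import`); as for stub 3
(`stub_levyFloor_explicit`, landed twin files `…KernelPositivity`, `…BlockSums`), the stub is proved
here with those abbreviations UNFOLDED verbatim and registered as `stub_levyMassBranch_explicit`, so
that in `Lines/birth.lean` `stub_levyMassBranch := stub_levyMassBranch_explicit` (definitional
unfolding). Statement: for every even `M ≥ 4` there is `g : ℝ → ℝ`, continuous on `[-1, 0]`, such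
that at every `Δ ∈ [-1,0]` a normalised `S^z_tot = 0` sector ground state of
`H_M(Δ) = xxzHamiltonian 1 (torusGraph 2 M) (-1) Δ` EXISTS and EVERY such ground state `ψ` has Lévy
mass `|ν|(ψ) = M⁻² Σ_x −log(K₂(x,0)/K₂(0,0))` equal to `g Δ` (`K₂` the 2×2-block transverse kernel).

Proof: `g Δ :=` the Lévy mass of a chosen normalised sector ground state — one exists for EVERY
real `Δ` and sector ground states are unique up to scalars (Perron–Frobenius, landed
`xxz_sector_perronFrobenius`; `halfFilledGS_exists_and_unique`), so every normalised ground state is a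
unimodular multiple of the chosen one, with the same Lévy mass (`levyMassExpr_smul_of_unit`).
Continuity of `g` on `ℝ` is the abstract principle
`EigenvalueContinuation.continuousOn_groundState_observable`
(`Literature/…/SectorGroundStateContinuity.lean`: compactness of the unit sphere of the sector +
uniqueness) fed with: `Δ ↦ H_M(Δ)` continuous (affine: `xxzHamiltonian_eq_add_smul`); energies
Lipschitz in `Δ` (`xxzHamiltonian_energy_lipschitz`); the sector energy
`lowestEnergyInSector = minEnergyOn` is a variational floor on the sector
(`minEnergyOn_mul_le_rayleigh`) attained at the ground state; the Lévy mass is continuous at every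
ground state since all block entries `K₂(X,0)` are positive there (`blockEntry_pos`, from the landed
all-`Δ` Perron positivity `transverseKernelPos_allDelta`) and is phase blind.

Sources: T. Kato, *Perturbation Theory for Linear Operators* II-§1.4/§5.1; H. Tasaki (2020) §2.4;
E. H. Lieb, F. Y. Wu, Physica A 321 (2003) §2. No definition is introduced; sorry-free; axioms
`[propext, Classical.choice, Quot.sound]`. -/

noncomputable section

-- `dupNamespace`: the summit and the problem are both named `HubbardSuperconductivity` (layout D-0022)
set_option linter.dupNamespace false

namespace Summit.HubbardSuperconductivity.HubbardSuperconductivity.Theorems.LevyLogBootstrap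

open scoped BigOperators Matrix ComplexOrder ComplexConjugate
open Matrix Finset Complex Filter Topology
open Literature.MathematicalPhysics.QuantumLattice Literature.Probability.LatticeModels
open Literature.MathematicalPhysics.QuantumLattice.EigenvalueContinuation
open Summit.AtomisticToContinuum.BoseEinsteinCondensation.Theorems.BECStronglyRayleighSectorPerron
open Summit.AtomisticToContinuum.BoseEinsteinCondensation.Theorems.InsertionFieldDelocalisation.Negative
open Summit.HubbardSuperconductivity.HubbardSuperconductivity.Theorems.PolyaSchurPairBoson

namespace LevyMassBranch

/-! ### The XXZ family is affine in `Δ`; Lipschitz energies; variational floor -/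

section Family

variable {Λ : Type*} [Fintype Λ] [DecidableEq Λ]

/-- The `SᶻSᶻ` part of the XXZ Hamiltonian: `J Σ_{{x,y}∈E} Sᶻ_x Sᶻ_y`. [folklore] -/
theorem xxzHamiltonian_eq_add_smul (n : ℕ) (G : SimpleGraph Λ) [DecidableRel G.Adj] (J Δ : ℝ) :
    xxzHamiltonian n G J Δ = xxzHamiltonian n G J 0 +
      ((Δ : ℝ) : ℂ) • ((J : ℂ) • ∑ e ∈ G.edgeFinset,
        Sym2.lift ⟨fun x y => spinBond n 2 x y, fun x y => by simp only [spinBond_comm]⟩ e) := by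
  simp only [xxzHamiltonian, Finset.smul_sum, ← Finset.sum_add_distrib]
  refine Finset.sum_congr rfl fun e _ => ?_
  induction e using Sym2.ind with
  | h x y =>
    simp only [Sym2.lift_mk, Complex.ofReal_zero, zero_smul, add_zero, smul_add, smul_smul,
      mul_comm (J : ℂ) ((Δ : ℝ) : ℂ)]

/-- `Δ ↦ xxzHamiltonian n G J Δ` is continuous (indeed affine). [folklore] -/
theorem continuous_xxzHamiltonian (n : ℕ) (G : SimpleGraph Λ) [DecidableRel G.Adj] (J : ℝ) :
    Continuous fun Δ : ℝ => xxzHamiltonian n G J Δ := by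
  have h : (fun Δ : ℝ => xxzHamiltonian n G J Δ) = fun Δ : ℝ => xxzHamiltonian n G J 0 +
      ((Δ : ℝ) : ℂ) • ((J : ℂ) • ∑ e ∈ G.edgeFinset,
        Sym2.lift ⟨fun x y => spinBond n 2 x y, fun x y => by simp only [spinBond_comm]⟩ e) :=
    funext fun Δ => xxzHamiltonian_eq_add_smul n G J Δ
  rw [h]
  exact continuous_const.add (Complex.continuous_ofReal.smul continuous_const)

/-- Crude form bound: `|Re⟨v, Z v⟩| ≤ (Σ_{i,j} ‖Z_{ij}‖) ‖v‖²` for every matrix `Z`. [folklore] -/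
theorem abs_re_expect_le_sum_norm_mul {ι : Type*} [Fintype ι] (Z : Matrix ι ι ℂ) (v : ι → ℂ) :
    |(star v ⬝ᵥ Z *ᵥ v).re| ≤ (∑ i, ∑ j, ‖Z i j‖) * (star v ⬝ᵥ v).re := by
  have hR := re_star_dotProduct_self_nonneg v
  have hsq : ∀ i, ‖v i‖ ^ 2 ≤ (star v ⬝ᵥ v).re := norm_apply_sq_le v
  have hprod : ∀ i j, ‖v i‖ * ‖v j‖ ≤ (star v ⬝ᵥ v).re := fun i j => by
    nlinarith [hsq i, hsq j, sq_nonneg (‖v i‖ - ‖v j‖), norm_nonneg (v i), norm_nonneg (v j)]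
  calc |(star v ⬝ᵥ Z *ᵥ v).re| ≤ ‖star v ⬝ᵥ Z *ᵥ v‖ := Complex.abs_re_le_norm _
    _ = ‖∑ i, star (v i) * ∑ j, Z i j * v j‖ := by simp only [dotProduct, mulVec, Pi.star_apply]
    _ ≤ ∑ i, ‖star (v i) * ∑ j, Z i j * v j‖ := norm_sum_le _ _
    _ ≤ ∑ i, ∑ j, ‖Z i j‖ * (star v ⬝ᵥ v).re := by
        refine Finset.sum_le_sum fun i _ => ?_
        rw [norm_mul, norm_star]
        calc ‖v i‖ * ‖∑ j, Z i j * v j‖ ≤ ‖v i‖ * ∑ j, ‖Z i j * v j‖ :=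
              mul_le_mul_of_nonneg_left (norm_sum_le _ _) (norm_nonneg _)
          _ = ∑ j, ‖Z i j‖ * (‖v i‖ * ‖v j‖) := by
              rw [Finset.mul_sum]
              refine Finset.sum_congr rfl fun j _ => ?_
              rw [norm_mul]; ring
          _ ≤ ∑ j, ‖Z i j‖ * (star v ⬝ᵥ v).re :=
              Finset.sum_le_sum fun j _ => mul_le_mul_of_nonneg_left (hprod i j) (norm_nonneg _)
    _ = (∑ i, ∑ j, ‖Z i j‖) * (star v ⬝ᵥ v).re := by rw [Finset.sum_mul]; simp only [Finset.sum_mul]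

/-- **The energies of the XXZ family are Lipschitz in `Δ`** (they are affine in `Δ`, with slope the
`SᶻSᶻ` form). [folklore] -/
theorem xxzHamiltonian_energy_lipschitz (n : ℕ) (G : SimpleGraph Λ) [DecidableRel G.Adj] (J : ℝ) :
    ∃ d : ℝ, 0 ≤ d ∧ ∀ (Δ Δ' : ℝ) (v : TensorIndex Λ (n + 1) → ℂ),
      |(star v ⬝ᵥ xxzHamiltonian n G J Δ *ᵥ v).re - (star v ⬝ᵥ xxzHamiltonian n G J Δ' *ᵥ v).re| ≤
        d * |Δ - Δ'| * (star v ⬝ᵥ v).re := by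
  set Z : Op Λ (n + 1) := (J : ℂ) • ∑ e ∈ G.edgeFinset,
    Sym2.lift ⟨fun x y => spinBond n 2 x y, fun x y => by simp only [spinBond_comm]⟩ e with hZ
  refine ⟨∑ i, ∑ j, ‖Z i j‖, Finset.sum_nonneg fun i _ => Finset.sum_nonneg fun j _ => norm_nonneg _,
    fun Δ Δ' v => ?_⟩
  have hdiff : (star v ⬝ᵥ xxzHamiltonian n G J Δ *ᵥ v).re -
      (star v ⬝ᵥ xxzHamiltonian n G J Δ' *ᵥ v).re = (Δ - Δ') * (star v ⬝ᵥ Z *ᵥ v).re := by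
    rw [xxzHamiltonian_eq_add_smul n G J Δ, xxzHamiltonian_eq_add_smul n G J Δ', ← hZ]
    simp only [add_mulVec, Matrix.smul_mulVec, dotProduct_add, dotProduct_smul, smul_eq_mul,
      Complex.add_re, Complex.re_ofReal_mul]
    ring
  rw [hdiff, abs_mul]
  calc |Δ - Δ'| * |(star v ⬝ᵥ Z *ᵥ v).re|
      ≤ |Δ - Δ'| * ((∑ i, ∑ j, ‖Z i j‖) * (star v ⬝ᵥ v).re) :=
        mul_le_mul_of_nonneg_left (abs_re_expect_le_sum_norm_mul Z v) (abs_nonneg _)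
    _ = (∑ i, ∑ j, ‖Z i j‖) * |Δ - Δ'| * (star v ⬝ᵥ v).re := by ring

/-- **Variational floor of a sector energy**: `E_min(K) ‖v‖² ≤ Re⟨v, H v⟩` for every `v ∈ K`
(`minEnergyOn_le_rayleigh_of_mem` on the normalised vector). Tasaki (2020) §2.2. [folklore] -/
theorem minEnergyOn_mul_le_rayleigh {ι : Type*} [Fintype ι] [DecidableEq ι] {H : Matrix ι ι ℂ}
    (hH : H.IsHermitian) (K : Submodule ℂ (ι → ℂ)) {v : ι → ℂ} (hv : v ∈ K) :
    H.minEnergyOn K * (star v ⬝ᵥ v).re ≤ (star v ⬝ᵥ H *ᵥ v).re := by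
  by_cases hv0 : v = 0
  · subst hv0
    simp
  obtain ⟨c, hc, hcc, hc1⟩ := exists_normalize hv0
  have hmem : ((c : ℂ) • v) ∈ K := K.smul_mem _ hv
  have h := minEnergyOn_le_rayleigh_of_mem hH K hmem hc1
  have hq : (star ((c : ℂ) • v) ⬝ᵥ H *ᵥ ((c : ℂ) • v)).re = c * c * (star v ⬝ᵥ H *ᵥ v).re := by
    rw [mulVec_smul, star_smul, smul_dotProduct, dotProduct_smul, smul_smul, Complex.star_def,
      Complex.conj_ofReal, smul_eq_mul, ← Complex.ofReal_mul, Complex.re_ofReal_mul]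
  rw [hq] at h
  have hpos : 0 < c * c := mul_pos hc hc
  have h2 : H.minEnergyOn K * (c * c * (star v ⬝ᵥ v).re) ≤ c * c * (star v ⬝ᵥ H *ᵥ v).re := by
    rw [hcc, mul_one]; exact h
  nlinarith [re_star_dotProduct_self_nonneg v]

end Family

/-! ### The explicit block kernel and Lévy mass: continuity, positivity, phase blindness -/

section Explicit

variable (M : ℕ) [NeZero M]

/-- Expectations are blind to phases: `⟨cψ, A cψ⟩ = ⟨ψ, A ψ⟩` for `|c| = 1`. [folklore] -/
theorem expect_smul_of_unit {ι : Type*} [Fintype ι] (c : ℂ) (hc : star c * c = 1)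
    (A : Matrix ι ι ℂ) (ψ : ι → ℂ) : star (c • ψ) ⬝ᵥ A *ᵥ (c • ψ) = star ψ ⬝ᵥ A *ᵥ ψ := by
  rw [mulVec_smul, star_smul, smul_dotProduct, dotProduct_smul, smul_smul, hc, one_smul]

/-- The 2×2-block transverse kernel entry `K₂(x,y) = Σ_{x'∈B(x), y'∈B(y)} Re⟨ψ, S⁺_{x'}S⁻_{y'}ψ⟩`
(written out as in `Block2InfDivXXZ` / the `LevyTransport` skeleton) is a continuous function of the
state. [folklore] -/
theorem continuous_blockEntry (x y : TorusSite 2 M) :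
    Continuous fun ψ : TensorIndex (TorusSite 2 M) 2 → ℂ =>
      (∑ x' : TorusSite 2 M, ∑ y' : TorusSite 2 M,
        if (∀ i : Fin 2, (x' i).val / 2 = (x i).val / 2) ∧
          (∀ i : Fin 2, (y' i).val / 2 = (y i).val / 2)
        then (star ψ ⬝ᵥ Matrix.mulVec (onSite x' (spinRaise 1) * onSite y' (spinLower 1)) ψ).re else 0) := by
  refine continuous_finsetSum _ fun x' _ => continuous_finsetSum _ fun y' _ => ?_
  split_ifs
  · exact continuous_energy _
  · exact continuous_const

/-- Every block entry `K₂(X, 0)` of a normalised half-filled sector ground state is strictly positive,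
at EVERY real `Δ` (it dominates the pair `(X, 0)`; Perron positivity `transverseKernelPos_allDelta`).
[folklore] -/
theorem blockEntry_pos (hEven : Even M) (h4 : 4 ≤ M) (Δ : ℝ)
    (ψ : TensorIndex (TorusSite 2 M) 2 → ℂ) (hψ : ψ ∈ @spinZSector (TorusSite 2 M) _ _ 1 0)
    (hnorm : star ψ ⬝ᵥ ψ = 1)
    (heig : Matrix.mulVec (xxzHamiltonian 1 (torusGraph 2 M) (-1) Δ) ψ =
      ((lowestEnergyInSector 1 (xxzHamiltonian 1 (torusGraph 2 M) (-1) Δ) 0 : ℝ) : ℂ) • ψ)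
    (X : TorusSite 2 M) :
    0 < (∑ x' : TorusSite 2 M, ∑ y' : TorusSite 2 M,
        if (∀ i : Fin 2, (x' i).val / 2 = (X i).val / 2) ∧
          (∀ i : Fin 2, (y' i).val / 2 = ((0 : TorusSite 2 M) i).val / 2)
        then (star ψ ⬝ᵥ Matrix.mulVec (onSite x' (spinRaise 1) * onSite y' (spinLower 1)) ψ).re else 0) := by
  have hK : ∀ x' y' : TorusSite 2 M, 0 < (star ψ ⬝ᵥ Matrix.mulVec (onSite x' (spinRaise 1) * onSite y' (spinLower 1)) ψ).re :=
    fun x' y' => transverseKernelPos_allDelta M hEven h4 Δ ψ hψ hnorm heig x' y'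
  have hnn : ∀ x' y' : TorusSite 2 M, 0 ≤
      (if (∀ i : Fin 2, (x' i).val / 2 = (X i).val / 2) ∧
          (∀ i : Fin 2, (y' i).val / 2 = ((0 : TorusSite 2 M) i).val / 2)
      then (star ψ ⬝ᵥ Matrix.mulVec (onSite x' (spinRaise 1) * onSite y' (spinLower 1)) ψ).re else 0) := fun x' y' => by
    split_ifs
    · exact (hK x' y').le
    · exact le_rfl
  have hXX : (if (∀ i : Fin 2, (X i).val / 2 = (X i).val / 2) ∧
          (∀ i : Fin 2, ((0 : TorusSite 2 M) i).val / 2 = ((0 : TorusSite 2 M) i).val / 2)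
      then (star ψ ⬝ᵥ Matrix.mulVec (onSite X (spinRaise 1) * onSite 0 (spinLower 1)) ψ).re else 0) = (star ψ ⬝ᵥ Matrix.mulVec (onSite X (spinRaise 1) * onSite 0 (spinLower 1)) ψ).re :=
    if_pos ⟨fun _ => rfl, fun _ => rfl⟩
  calc (0 : ℝ) < (star ψ ⬝ᵥ Matrix.mulVec (onSite X (spinRaise 1) * onSite 0 (spinLower 1)) ψ).re := hK X 0
    _ = _ := hXX.symm
    _ ≤ ∑ y' : TorusSite 2 M,
          (if (∀ i : Fin 2, (X i).val / 2 = (X i).val / 2) ∧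
              (∀ i : Fin 2, (y' i).val / 2 = ((0 : TorusSite 2 M) i).val / 2)
          then (star ψ ⬝ᵥ Matrix.mulVec (onSite X (spinRaise 1) * onSite y' (spinLower 1)) ψ).re else 0) :=
        Finset.single_le_sum (fun y' _ => hnn X y') (Finset.mem_univ 0)
    _ ≤ _ := Finset.single_le_sum (fun x' _ => Finset.sum_nonneg fun y' _ => hnn x' y')
          (Finset.mem_univ X)

/-- The Lévy mass `|ν|(ψ) = M⁻² Σ_x −log(K₂(x,0)/K₂(0,0))` (written out) is continuous at every state
whose block entries `K₂(X,0)` are all positive. [folklore] -/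
theorem continuousAt_levyMassExpr (ψ : TensorIndex (TorusSite 2 M) 2 → ℂ)
    (hpos : ∀ X : TorusSite 2 M, 0 < (∑ x' : TorusSite 2 M, ∑ y' : TorusSite 2 M,
        if (∀ i : Fin 2, (x' i).val / 2 = (X i).val / 2) ∧
          (∀ i : Fin 2, (y' i).val / 2 = ((0 : TorusSite 2 M) i).val / 2)
        then (star ψ ⬝ᵥ Matrix.mulVec (onSite x' (spinRaise 1) * onSite y' (spinLower 1)) ψ).re else 0)) :
    ContinuousAt (fun φ : TensorIndex (TorusSite 2 M) 2 → ℂ =>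
      ((∑ x : TorusSite 2 M, -Real.log ((∑ x' : TorusSite 2 M, ∑ y' : TorusSite 2 M,
        if (∀ i : Fin 2, (x' i).val / 2 = (x i).val / 2) ∧
          (∀ i : Fin 2, (y' i).val / 2 = ((0 : TorusSite 2 M) i).val / 2)
        then (star φ ⬝ᵥ Matrix.mulVec (onSite x' (spinRaise 1) * onSite y' (spinLower 1)) φ).re else 0) /
      (∑ x' : TorusSite 2 M, ∑ y' : TorusSite 2 M,
        if (∀ i : Fin 2, (x' i).val / 2 = ((0 : TorusSite 2 M) i).val / 2) ∧
          (∀ i : Fin 2, (y' i).val / 2 = ((0 : TorusSite 2 M) i).val / 2)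
        then (star φ ⬝ᵥ Matrix.mulVec (onSite x' (spinRaise 1) * onSite y' (spinLower 1)) φ).re else 0))) / (M : ℝ) ^ 2)) ψ := by
  have hterm : ∀ X : TorusSite 2 M, ContinuousAt
      (fun φ : TensorIndex (TorusSite 2 M) 2 → ℂ =>
        -Real.log ((∑ x' : TorusSite 2 M, ∑ y' : TorusSite 2 M,
        if (∀ i : Fin 2, (x' i).val / 2 = (X i).val / 2) ∧
          (∀ i : Fin 2, (y' i).val / 2 = ((0 : TorusSite 2 M) i).val / 2)
        then (star φ ⬝ᵥ Matrix.mulVec (onSite x' (spinRaise 1) * onSite y' (spinLower 1)) φ).re else 0) /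
          (∑ x' : TorusSite 2 M, ∑ y' : TorusSite 2 M,
        if (∀ i : Fin 2, (x' i).val / 2 = ((0 : TorusSite 2 M) i).val / 2) ∧
          (∀ i : Fin 2, (y' i).val / 2 = ((0 : TorusSite 2 M) i).val / 2)
        then (star φ ⬝ᵥ Matrix.mulVec (onSite x' (spinRaise 1) * onSite y' (spinLower 1)) φ).re else 0))) ψ := fun X =>
    ((((continuous_blockEntry M X 0).continuousAt).div
      ((continuous_blockEntry M 0 0).continuousAt) (hpos 0).ne').log
        (div_ne_zero (hpos X).ne' (hpos 0).ne')).neg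
  exact (tendsto_finsetSum _ fun X _ => hterm X).div_const _

/-- The Lévy mass (written out) is blind to phases: `|ν|(cψ) = |ν|(ψ)` for `|c| = 1`. [folklore] -/
theorem levyMassExpr_smul_of_unit (c : ℂ) (ψ : TensorIndex (TorusSite 2 M) 2 → ℂ)
    (hc : star c * c = 1) :
    ((∑ x : TorusSite 2 M, -Real.log ((∑ x' : TorusSite 2 M, ∑ y' : TorusSite 2 M,
        if (∀ i : Fin 2, (x' i).val / 2 = (x i).val / 2) ∧
          (∀ i : Fin 2, (y' i).val / 2 = ((0 : TorusSite 2 M) i).val / 2)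
        then (star (c • ψ) ⬝ᵥ Matrix.mulVec (onSite x' (spinRaise 1) * onSite y' (spinLower 1)) (c • ψ)).re else 0) /
      (∑ x' : TorusSite 2 M, ∑ y' : TorusSite 2 M,
        if (∀ i : Fin 2, (x' i).val / 2 = ((0 : TorusSite 2 M) i).val / 2) ∧
          (∀ i : Fin 2, (y' i).val / 2 = ((0 : TorusSite 2 M) i).val / 2)
        then (star (c • ψ) ⬝ᵥ Matrix.mulVec (onSite x' (spinRaise 1) * onSite y' (spinLower 1)) (c • ψ)).re else 0))) / (M : ℝ) ^ 2) =
    ((∑ x : TorusSite 2 M, -Real.log ((∑ x' : TorusSite 2 M, ∑ y' : TorusSite 2 M,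
        if (∀ i : Fin 2, (x' i).val / 2 = (x i).val / 2) ∧
          (∀ i : Fin 2, (y' i).val / 2 = ((0 : TorusSite 2 M) i).val / 2)
        then (star ψ ⬝ᵥ Matrix.mulVec (onSite x' (spinRaise 1) * onSite y' (spinLower 1)) ψ).re else 0) /
      (∑ x' : TorusSite 2 M, ∑ y' : TorusSite 2 M,
        if (∀ i : Fin 2, (x' i).val / 2 = ((0 : TorusSite 2 M) i).val / 2) ∧
          (∀ i : Fin 2, (y' i).val / 2 = ((0 : TorusSite 2 M) i).val / 2)
        then (star ψ ⬝ᵥ Matrix.mulVec (onSite x' (spinRaise 1) * onSite y' (spinLower 1)) ψ).re else 0))) / (M : ℝ) ^ 2) := by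
  simp_rw [expect_smul_of_unit c hc]

end Explicit

/-! ### Normalised sector ground states at every anisotropy -/

section GroundStates

variable (M : ℕ) [NeZero M]

/-- For even `M`, every real `Δ` admits a normalised `S^z_tot = 0` sector ground state of
`H_M(Δ)`, and sector ground states are unique up to scalars (Perron–Frobenius,
`xxz_sector_perronFrobenius`). [folklore] -/
theorem halfFilledGS_exists_and_unique (hEven : Even M) (Δ : ℝ) :
    (∃ ψ : TensorIndex (TorusSite 2 M) 2 → ℂ, ψ ∈ @spinZSector (TorusSite 2 M) _ _ 1 0 ∧
      star ψ ⬝ᵥ ψ = 1 ∧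
      Matrix.mulVec (xxzHamiltonian 1 (torusGraph 2 M) (-1) Δ) ψ =
        ((lowestEnergyInSector 1 (xxzHamiltonian 1 (torusGraph 2 M) (-1) Δ) 0 : ℝ) : ℂ) • ψ) ∧
    (∀ ψ φ : TensorIndex (TorusSite 2 M) 2 → ℂ,
      ψ ∈ @spinZSector (TorusSite 2 M) _ _ 1 0 → φ ∈ @spinZSector (TorusSite 2 M) _ _ 1 0 →
      Matrix.mulVec (xxzHamiltonian 1 (torusGraph 2 M) (-1) Δ) ψ =
        ((lowestEnergyInSector 1 (xxzHamiltonian 1 (torusGraph 2 M) (-1) Δ) 0 : ℝ) : ℂ) • ψ →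
      Matrix.mulVec (xxzHamiltonian 1 (torusGraph 2 M) (-1) Δ) φ =
        ((lowestEnergyInSector 1 (xxzHamiltonian 1 (torusGraph 2 M) (-1) Δ) 0 : ℝ) : ℂ) • φ →
      ψ ≠ 0 → ∃ c : ℂ, φ = c • ψ) := by
  obtain ⟨k, hk⟩ := hEven
  set W : ℕ := 2 * k * k with hWdef
  have hM2 : M ^ 2 = 4 * k * k := by rw [hk]; ring
  have hWle : W ≤ M ^ 2 := by rw [hM2, hWdef]; nlinarith
  have hsecR : ((Fintype.card (TorusSite 2 M) * 1 : ℕ) : ℝ) / 2 - (W : ℝ) = 0 := by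
    rw [card_torusSite, hWdef, hk]
    push_cast
    ring
  obtain ⟨⟨ψ₀, hψ₀K, hψ₀0, -, hHψ₀⟩, huniq⟩ :=
    xxz_sector_perronFrobenius (torusGraph 2 M) (torusGraph_connected 2 M) Δ W
      (exists_config_weight_eq 2 M W hWle)
  rw [hsecR] at hψ₀K hHψ₀ huniq
  refine ⟨?_, huniq⟩
  obtain ⟨c, hc, -, hc1⟩ := exists_normalize hψ₀0
  refine ⟨(c : ℂ) • ψ₀, Submodule.smul_mem _ _ hψ₀K, hc1, ?_⟩
  rw [mulVec_smul, hHψ₀, smul_comm]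

end GroundStates

end LevyMassBranch

open LevyMassBranch

/-! ### The stub (registered explicit form) -/

/-- **`stub_levyMassBranch_explicit`** (crux `LevyTransport`, skeleton `Cruxes/LevyTransport/Lines/birth.lean`,
stub 1 `stub_levyMassBranch` with the skeleton abbreviations `IsHalfFilledGS`/`blockKernel`/`levyMass`
unfolded; registered signature): for every even `M ≥ 4` there is `g : ℝ → ℝ`, continuous on `[-1,0]`,
such that at every `Δ ∈ [-1,0]` a normalised `S^z_tot = 0` sector ground state of `H_M(Δ)` exists and
every such ground state has Lévy mass `g Δ`. Perron–Frobenius existence/uniqueness at every real `Δ`,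
phase blindness, and `continuousOn_groundState_observable` (continuity of `Δ ↦ H_M(Δ)`, Lipschitz
energies, variational floor, continuity of the Lévy mass at ground states). Kato (1966) II-§1;
Tasaki (2020) §2.4; Lieb–Wu (2003) §2. [folklore] -/
theorem stub_levyMassBranch_explicit :
    ∀ (M : ℕ) [NeZero M], Even M → 4 ≤ M →
      ∃ g : ℝ → ℝ, ContinuousOn g (Set.Icc (-1:ℝ) 0) ∧ ∀ Δ ∈ Set.Icc (-1:ℝ) 0,
        (∃ ψ : TensorIndex (TorusSite 2 M) 2 → ℂ,
          (ψ ∈ @spinZSector (TorusSite 2 M) _ _ 1 0 ∧ star ψ ⬝ᵥ ψ = 1 ∧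
      Matrix.mulVec (xxzHamiltonian 1 (torusGraph 2 M) (-1) Δ) ψ =
        ((lowestEnergyInSector 1 (xxzHamiltonian 1 (torusGraph 2 M) (-1) Δ) 0 : ℝ) : ℂ) • ψ)) ∧
        ∀ ψ : TensorIndex (TorusSite 2 M) 2 → ℂ,
          (ψ ∈ @spinZSector (TorusSite 2 M) _ _ 1 0 ∧ star ψ ⬝ᵥ ψ = 1 ∧
      Matrix.mulVec (xxzHamiltonian 1 (torusGraph 2 M) (-1) Δ) ψ =
        ((lowestEnergyInSector 1 (xxzHamiltonian 1 (torusGraph 2 M) (-1) Δ) 0 : ℝ) : ℂ) • ψ) →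
          ((∑ x : TorusSite 2 M, -Real.log ((∑ x' : TorusSite 2 M, ∑ y' : TorusSite 2 M,
        if (∀ i : Fin 2, (x' i).val / 2 = (x i).val / 2) ∧
          (∀ i : Fin 2, (y' i).val / 2 = ((0 : TorusSite 2 M) i).val / 2)
        then (star ψ ⬝ᵥ Matrix.mulVec (onSite x' (spinRaise 1) * onSite y' (spinLower 1)) ψ).re else 0) /
      (∑ x' : TorusSite 2 M, ∑ y' : TorusSite 2 M,
        if (∀ i : Fin 2, (x' i).val / 2 = ((0 : TorusSite 2 M) i).val / 2) ∧
          (∀ i : Fin 2, (y' i).val / 2 = ((0 : TorusSite 2 M) i).val / 2)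
        then (star ψ ⬝ᵥ Matrix.mulVec (onSite x' (spinRaise 1) * onSite y' (spinLower 1)) ψ).re else 0))) / (M : ℝ) ^ 2) = g Δ := by
  intro M _ hEven h4
  set K : Submodule ℂ (TensorIndex (TorusSite 2 M) 2 → ℂ) := @spinZSector (TorusSite 2 M) _ _ 1 0
    with hKdef
  set A : ℝ → Op (TorusSite 2 M) 2 := fun Δ => xxzHamiltonian 1 (torusGraph 2 M) (-1) Δ with hAdef
  set m : ℝ → ℝ := fun Δ => lowestEnergyInSector 1 (xxzHamiltonian 1 (torusGraph 2 M) (-1) Δ) 0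
    with hmdef
  set F : (TensorIndex (TorusSite 2 M) 2 → ℂ) → ℝ := fun ψ =>
    ((∑ x : TorusSite 2 M, -Real.log ((∑ x' : TorusSite 2 M, ∑ y' : TorusSite 2 M,
        if (∀ i : Fin 2, (x' i).val / 2 = (x i).val / 2) ∧
          (∀ i : Fin 2, (y' i).val / 2 = ((0 : TorusSite 2 M) i).val / 2)
        then (star ψ ⬝ᵥ Matrix.mulVec (onSite x' (spinRaise 1) * onSite y' (spinLower 1)) ψ).re else 0) /
      (∑ x' : TorusSite 2 M, ∑ y' : TorusSite 2 M,
        if (∀ i : Fin 2, (x' i).val / 2 = ((0 : TorusSite 2 M) i).val / 2) ∧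
          (∀ i : Fin 2, (y' i).val / 2 = ((0 : TorusSite 2 M) i).val / 2)
        then (star ψ ⬝ᵥ Matrix.mulVec (onSite x' (spinRaise 1) * onSite y' (spinLower 1)) ψ).re else 0))) / (M : ℝ) ^ 2) with hFdef
  have hex := fun Δ => (halfFilledGS_exists_and_unique M hEven Δ).1
  have hun := fun Δ => (halfFilledGS_exists_and_unique M hEven Δ).2
  -- the chosen branch
  choose ψs hψsK hψs1 hψseq using hex
  set g : ℝ → ℝ := fun Δ => F (ψs Δ) with hgdef
  -- `g` agrees with the Lévy mass of every normalised ground state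
  have hg : ∀ Δ (ψ : TensorIndex (TorusSite 2 M) 2 → ℂ), ψ ∈ K → star ψ ⬝ᵥ ψ = 1 →
      A Δ *ᵥ ψ = (m Δ : ℂ) • ψ → g Δ = F ψ := by
    intro Δ ψ hψK hψ1 hψeq
    have h0 : ψs Δ ≠ 0 := by
      intro h
      have := hψs1 Δ
      rw [h, star_zero, zero_dotProduct] at this
      exact zero_ne_one this
    obtain ⟨c, hc⟩ := hun Δ (ψs Δ) ψ (hψsK Δ) hψK (hψseq Δ) hψeq h0
    have hcc : star c * c = 1 := by
      have h := hψ1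
      rw [hc, star_smul, smul_dotProduct, dotProduct_smul, smul_smul, hψs1 Δ, smul_eq_mul,
        mul_one] at h
      exact h
    rw [hgdef, hc]
    exact (levyMassExpr_smul_of_unit M c (ψs Δ) hcc).symm
  obtain ⟨d, -, hlip⟩ := xxzHamiltonian_energy_lipschitz 1 (torusGraph 2 M) (-1)
  have hcont : ContinuousOn g Set.univ := by
    refine continuousOn_groundState_observable K A (continuous_xxzHamiltonian 1 (torusGraph 2 M) (-1))
      m Set.univ (d := d) (fun u _ u' _ v _ => hlip u u' v)
      (fun u _ v hv => ?_) (fun u _ => ⟨ψs u, hψsK u, hψs1 u, hψseq u⟩)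
      (fun u _ ψ₁ hψ₁ ψ₂ hψ₂ h0 h1 h2 => hun u ψ₁ ψ₂ hψ₁ hψ₂ h1 h2 h0) F
      (fun u _ ψ hψK hψ1 hψeq => continuousAt_levyMassExpr M ψ fun X =>
        blockEntry_pos M hEven h4 u ψ hψK hψ1 hψeq X)
      (fun c ψ hc => levyMassExpr_smul_of_unit M c ψ hc) g
      (fun u _ ψ hψK hψ1 hψeq => hg u ψ hψK hψ1 hψeq)
    exact minEnergyOn_mul_le_rayleigh (xxzHamiltonian_isHermitian 1 (torusGraph 2 M) (-1) u) K hv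
  refine ⟨g, hcont.mono (Set.subset_univ _), fun Δ _ => ⟨⟨ψs Δ, hψsK Δ, hψs1 Δ, hψseq Δ⟩, ?_⟩⟩
  intro ψ hgs
  obtain ⟨hψK, hψ1, hψeq⟩ := hgs
  exact (hg Δ ψ hψK hψ1 hψeq).symm

end Summit.HubbardSuperconductivity.HubbardSuperconductivity.Theorems.LevyLogBootstrap

end
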